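import Mathlib
import Literature.AlgebraicGeometry.Motives.Jacobian
import Literature.AlgebraicGeometry.Motives.SupersingularAbelianVariety
import Literature.AlgebraicGeometry.Motives.MotivatedPeriodTorsor
import Literature.AlgebraicGeometry.HodgeTheory.FermatHypersurfaceReduction
import Literature.AlgebraicGeometry.HodgeTheory.ComplexConjugationHolds
import Literature.AlgebraicGeometry.HodgeTheory.FermatHodgeClassesLiftToCurveAndJacobianPowers
import HarnessLib

/-!
# FermatHodgeClassesLiftToCurvePowersSum

Topic `Literature/AlgebraicGeometry/HodgeTheory`. Named literature fact(s) relocated by the gate from `Summits/HodgeConjecture/HodgeConjecture/Theorems/PadicSemiregularLiftFermatAnchorAssemblyStubTransferSum.lean`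
(accept-time relocation of `[cite]`d propositions written inline in a Summits proposal; human ruling 2026-08-15).
Sources: Fulton1998, Shioda1979HodgeFermat, ShiodaKatsura1979, Voisin2025.

* `Literature.AlgebraicGeometry.HodgeTheory.FermatHodgeClassesLiftToCurvePowersSum`
-/

namespace Literature.AlgebraicGeometry.HodgeTheory

open CategoryTheory AlgebraicGeometry
open Literature.AlgebraicGeometry Literature.AlgebraicGeometry.Motives
open Literature.AlgebraicTopology.SingularHomology

/-- **Fermat varieties are dominated by powers of the Fermat curve — Hodge-class form, MULTI-HOST
finite-sum version** (Shioda–Katsura 1979, §1–2; Shioda 1979, Thm. I). This SUPERSEDES the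
single-host `FermatHodgeClassesLiftToCurvePowers` (file `FermatHodgeClassesLiftToCurveAndJacobianPowers`),
which is FALSE as stated: at `(m, n, p) = (3, 2, 1)` the single host `C₃ × C₃` (`C₃` the Fermat
cubic, of genus `1`) has `dim_ℂ H²(C₃ × C₃) = 6`, while the Fermat cubic surface `X²₃` has `b₂ = 7`
with ALL of `H²(X²₃; ℚ) ≅ ℚ⁷` rational of type `(1, 1)` (the 27 lines), so no single linear
`F : H²(C₃²) → H²(X²₃)` has every rational `(1,1)`-class in its range — the domination
of `Xⁿₘ` by `C_mⁿ` is only RATIONAL. Shioda–Katsura, *On Fermat varieties*, §1 (Thm. 1.7, Cor. 1.11): for `r, s ≥ 1`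
the rational map `Xʳₘ × Xˢₘ ⇢ X^{r+s}ₘ`,
`([x], [y]) ↦ [x₀y_{s+1} : ⋯ : x_r y_{s+1} : εx_{r+1}y₀ : ⋯ : εx_{r+1}y_s]` (`εᵐ = -1`), becomes
a morphism `ψ : Z_{r,s} → X^{r+s}ₘ` of degree `m` on the blow-up `β : Z_{r,s} → Xʳₘ × Xˢₘ` along
`Y = X^{r-1}ₘ × X^{s-1}ₘ` (exceptional divisor `j : E ↪ Z_{r,s}`, a `ℙ¹`-bundle `π : E → Y`);
iterating, `Xⁿₘ` is dominated by `C_mⁿ`, `C_m = X¹ₘ` the Fermat curve. Cohomologically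
(§2, Lemma 2.1: `H*(Z_{r,s}) = β^*H*(Xʳₘ × Xˢₘ) ⊕ j_*π^*H^{*-2}(Y)(-1)`; Prop. 2.4 (2.5)), and
over `ℂ` with Hodge structures, Shioda, Math. Ann. 245 (1979), Thm. I: the algebraic correspondences
of the blow-up diagram (`ψ_* β^*` from `Xʳₘ × Xˢₘ`, `ψ_* j_* π^*` from the centre `Y`) induce an
isomorphism of `ℚ`-Hodge structures
`[Hʳ_prim(Xʳₘ) ⊗ Hˢ_prim(Xˢₘ)]^{μₘ} ⊕ [H^{r-1}_prim(X^{r-1}ₘ) ⊗ H^{s-1}_prim(X^{s-1}ₘ)](-1) ≅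
H^{r+s}_prim(X^{r+s}ₘ)` carrying algebraic cycles to algebraic cycles; the Tate-twisted summand
comes from the CENTRE of the blow-up and sits in degree `r + s - 2` on `X^{r-1}ₘ × X^{s-1}ₘ` — it is
not a quotient of `H*(Xʳₘ × Xˢₘ)`. Coarsely (`ψ_*ψ^* = m`, Künneth):
`Hᵈ(X^{r+s}ₘ, ℚ) = ψ_*β^*[H*(Xʳₘ) ⊗ H*(Xˢₘ)]_d + ψ_*j_*π^*[H*(X^{r-1}ₘ) ⊗ H*(X^{s-1}ₘ)]_{d-2}(-1)`.
Iterating with `s = 1` (`X⁰ₘ` = `m` points; a correspondence `Γ` from `C_mᵏ` extends to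
`Γ × Δ` from `C_mᵏ × W`, acting as `Γ_* ⊗ id` on Künneth components): `H²ᵖ(Xⁿₘ, ℚ)` is the SUM of
the images of finitely many algebraic correspondences `Γᵢ` from the cartesian powers `C_m^{kᵢ}`,
`kᵢ = n - 2j`, acting from degree `2qᵢ = 2(p - j)` (`j = 0, 1, …`; `kᵢ = 0` is the point
`C_m⁰ = Spec ℂ` with its degree-`0` classes, e.g. `1 ↦ hᵖ`), each
`Γᵢ,* : H^{2qᵢ}(C_m^{kᵢ}, ℚ)(qᵢ - p) → H²ᵖ(Xⁿₘ, ℚ)` a morphism of Hodge structures carrying classes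
of algebraic cycles to classes of algebraic cycles (correspondences between non-singular projective
varieties, Fulton Ch. 16 and Cor. 19.2), and Hodge classes lift along the resulting SURJECTION from
the polarisable direct sum `⊕ᵢ H^{2qᵢ}(C_m^{kᵢ}, ℚ)(qᵢ - p) ↠ H²ᵖ(Xⁿₘ, ℚ)` (Voisin 2025,
Cor. 2.12 with Prop. 2.11). On the tree's real carriers and for the standard models
`fermatHypersurface n m = V₊(Σ xᵢᵐ) ⊂ ℙⁿ⁺¹_ℂ`, `C_mᵏ = (fermatHypersurface 1 m).pow k`
(`Motives.SchemeOver.pow`, `pow 0 = 𝟙_ = Spec ℂ`): **for `m ≥ 1`, `n ≥ 1` and every `p` there are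
a finite index type `ι`, hosts `(kᵢ, qᵢ)ᵢ` and `ℂ`-linear maps
`Fᵢ : H^{2qᵢ}(C_m^{kᵢ}(ℂ); ℂ) → H²ᵖ(Xⁿₘ(ℂ); ℂ)` mapping `algebraicClasses (C_m^{kᵢ}) qᵢ` into
`algebraicClasses (Xⁿₘ) p`, such that every rational class of Hodge type `(p, p)` on `Xⁿₘ` is
`Σᵢ Fᵢ aᵢ` for rational classes `aᵢ` of Hodge type `(qᵢ, qᵢ)` on `C_m^{kᵢ}`** (`Fᵢ = Γᵢ,* ⊗ ℂ`;
`m = 1, 2`: `C_m ≅ ℙ¹`, all of `H²ᵖ(Xⁿₘ)` algebraic, point hosts suffice; `2p ≠ n`: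
`H²ᵖ(Xⁿₘ, ℚ) = ℚ hᵖ`, one point host; `2p > 2n`: no hosts).
[cite: ShiodaKatsura1979, §1 Thm. 1.7 and Cor. 1.11; §2 Lemma 2.1 and Prop. 2.4 (2.5)]
[cite: Shioda1979HodgeFermat, Thm. I (inductive structure of the cohomology, by algebraic correspondences)]
[cite: Voisin2025, Prop. 2.11 and Cor. 2.12] [cite: Fulton1998, Ch. 16 Def. 16.1.2 and §19.2 Cor. 19.2]
[file AlgebraicGeometry/HodgeTheory/FermatHodgeClassesLiftToCurvePowersSum] -/
def FermatHodgeClassesLiftToCurvePowersSum : Prop :=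
  ∀ (m n p : ℕ), 1 ≤ m → 1 ≤ n →
    ∃ (ι : Type) (_ : Fintype ι) (k q : ι → ℕ)
      (F : ∀ i, complexBetti ((fermatHypersurface 1 m).pow (k i)) (2 * q i) →ₗ[ℂ]
        complexBetti (fermatHypersurface n m) (2 * p)),
      (∀ i, ∀ a ∈ algebraicClasses ((fermatHypersurface 1 m).pow (k i)) (q i),
          F i a ∈ algebraicClasses (fermatHypersurface n m) p) ∧
      ∀ c : complexBetti (fermatHypersurface n m) (2 * p), IsRationalClass c →
        IsOfHodgeType n (fermatHypersurface n m) (2 * p) p p c →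
          ∃ a : ∀ i, complexBetti ((fermatHypersurface 1 m).pow (k i)) (2 * q i),
            (∀ i, IsRationalClass (a i) ∧
              IsOfHodgeType (k i) ((fermatHypersurface 1 m).pow (k i)) (2 * q i) (q i) (q i) (a i)) ∧
            c = ∑ i, F i (a i)

-- TODO(general form): Shioda's Thm. I is the ISOMORPHISM of Hodge structures above (primitive
-- parts, `μₘ`-invariants, Tate twists), induced by the explicit correspondences `ψ_* β^*`,
-- `ψ_* j_* π^*`; the tree has no correspondence action between distinct varieties nor Gysin maps
-- on its real carriers, so only this consequence for Hodge classes (finitely many hosts `C_mᵏ`,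
-- shifted degrees) is stated.

/-! ## The transfer, modulo the facts -/

end Literature.AlgebraicGeometry.HodgeTheory
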